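import Mathlib.NumberTheory.Modular
import Mathlib.NumberTheory.BernoulliPolynomials
import Mathlib.Analysis.Normed.Unbundled.RingSeminorm
import Literature.NumberTheory.EllipticCurves.NeronLocalHeight
import Literature.NumberTheory.EllipticCurves.ModularCurveKleinJ
import Literature.NumberTheory.EllipticCurves.RealLatticePeriod
import HarnessLib

/-!
# The Néron function on `ℂ/(ℤτ + ℤ)` and Hindry–Silverman's archimedean estimate (named facts)

Topic `NumberTheory/EllipticCurves` (family `abc`, G06). Next layer of the decomposition of the
named fact `Literature.NumberTheory.EllipticCurves.szpiro_imp_langHeightLowerBoundConjecture`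
(Szpiro ⇒ Lang's height lower bound over `ℚ`; Hindry–Silverman, Invent. Math. 93 (1988),
Thm. 0.3), below the archimedean step of Petsche's proof of his Proposition 7,
`Literature.NumberTheory.EllipticCurves.Petsche2006_exists_subset_le_neronLocalHeight_real`
(file `LangHeightSmallPoints.lean`; Petsche, New York J. Math. 12 (2006), proof of Prop. 7, the
paragraph "Divide the torus `ℂ/L` into the `24²` parallelograms …"). That paragraph uses exactly
two pieces of the archimedean theory of local heights, which this file vendors as named facts
(D-0014), together with the genuine definition they are about:

* `neronFunction τ z` — **the Néron function on the complex torus `ℂ/(ℤτ + ℤ)`** in the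
  `q`-expansion form of Silverman, *Advanced Topics*, Thm. VI.3.4 (p. 466):
  `λ(z) = −½ B₂(Im z / Im τ) log|q| − log|1 − u| − Σ_{n ≥ 1} log|(1 − qⁿu)(1 − qⁿu⁻¹)|`,
  `u = e^{2πiz}`, `q = e^{2πiτ}`, `B₂(T) = T² − T + 1/6` (`bernoulliTwo`); a real number for every
  `z : ℂ` (the series converges absolutely for all `z`; at `z ∈ ℤτ + ℤ` one factor vanishes and
  the value is junk);
* `neronLocalHeight_eq_neronFunction` — **ATAEC Thm. VI.3.4** (with Thm. VI.1.1(b)): for an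
  elliptic curve `E/ℂ` given by any Weierstrass equation `W`, identified with `ℂ/(ℤτ + ℤ)` through
  its analytic parametrisation, the Néron local height function `λ : E(ℂ) ∖ {O} → ℝ`
  (`WeierstrassCurve.Affine.Point.neronLocalHeight` for the usual absolute value of `ℂ`, i.e.
  Tate's series, `NeronLocalHeight.lean`) *is given by the formula* `λ(z) = neronFunction τ z`;
* `Petsche2006_lemma5` — **Petsche 2006, Lemma 5 (Hindry–Silverman)**: for a normalised lattice
  `L = ℤ + τℤ` and `z = r₁ + r₂τ ≠ 0` with `max{|r₁|, |r₂|} ≤ 1/24`,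
  `λ(z) ≥ (1/288) max{1, log|j(τ)|}` (Hindry–Silverman, Invent. Math. 93 (1988), Prop. 2.3;
  C. R. Acad. Sci. Paris 329 (1999), Lemme 1).

The sibling proof file `LangHeightArchEstimateProofs.lean` proves Petsche's archimedean step from
these two facts: the complex uniformisation of `E/ℚ` by a normalised lattice with
`|j(τ)| = |j_E|` is *proved* there from the tree (`PeriodPair.uniformization_holds`,
`PeriodPair.toPoint_add_holds`, `PeriodPair.exists_addMonoidHom_of_g₂_g₃`, Cox's Thm. 10.9
`PeriodPair.j_eq_iff`, `kleinJ_smul`, Mathlib's `ModularGroup.exists_smul_mem_fd`), as are the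
compatibility of Tate's series with `ℚ ⊂ ℂ` (ATAEC VI.1.1(c)) and the pigeonhole argument.

## Design choices

* `neronFunction` is the displayed formula of ATAEC Thm. VI.3.4 literally, with `log|q|` kept as
  `Real.log ‖e^{2πiτ}‖` (`= −2π Im τ`, `log_norm_cexp_two_pi_I_mul`) and the sum over `n ≥ 1` as a
  `tsum` over `n + 1`, `n : ℕ`. With the *polynomial* `B₂` and the argument `Im z / Im τ` the
  formula is `ℤτ + ℤ`-periodic and even in `z` as it stands (the shift of `B₂` compensates the
  re-indexing of the product; `neronFunction_add_one`, `neronFunction_neg` are proved here, the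
  `τ`-periodicity is not needed downstream). For the lattice `ℤτ + ℤ` we use the tree's
  `PeriodPair.ofUpperHalfPlane τ = (τ, 1)` (`RealLatticePeriod.lean`), `τ : ℍ`
  (Mathlib `UpperHalfPlane`).
* ATAEC VI.3.4 is printed for "an elliptic curve `E/ℂ` with lattice `ℤτ + ℤ`", identified with
  `ℂ/(ℤτ + ℤ)`; the local height `λ` does not depend on the Weierstrass equation (ATAEC
  Thm. VI.1.1(b)). For a Weierstrass equation `W` of `E` the period lattice of its invariant
  differential is `Λ_W = c(ℤτ + ℤ)` for some `c ∈ ℂˣ` (`g₂(Λ_W) = c₄/12`, `g₃(Λ_W) = c₆/216`), the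
  analytic isomorphism `ℂ/Λ_W ≅ W(ℂ)` is
  `w ↦ (℘(w) − b₂/12, (℘'(w) − a₁(℘(w) − b₂/12) − a₃)/2)` (AEC Prop. VI.3.6(b) transported along
  the change of variables to short normal form; the tree's
  `PeriodPair.exists_addMonoidHom_of_g₂_g₃`, `ComplexTorus.lean`), and `ℂ/(ℤτ + ℤ) ≅ E(ℂ)` is
  `z ↦ (this map)(cz)`. The fact `neronLocalHeight_eq_neronFunction` is stated in exactly this
  form, for every homomorphism `u : ℂ →+ W(ℂ)` given off `Λ_W` by that formula (such a `u` exists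
  and is unique off `Λ_W`; quantifying over it keeps the statement free of choice), and with the
  usual absolute value of `ℂ` as `NormedField.toAbsoluteValue ℂ`.
* Lemma 5 is printed for "a normalized lattice `L = ℤ + τℤ` with `τ ∈ ℍ`" without spelling out the
  normalisation; in Hindry–Silverman (1988, §2; 1999, Lemme 1) `τ` lies in the standard
  fundamental domain `{|τ| ≥ 1, |Re τ| ≤ ½}` of `SL₂(ℤ)`, which is how we state it (Mathlib
  `ModularGroup.fd`, notation `𝒟`; this is the strongest reading, so the fact is at most weaker than
  the printed lemma). `j(τ)` is the tree's `Literature.NumberTheory.EllipticCurves.ModularForms.kleinJ`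
  (`= E₄³/Δ = q⁻¹ + 744 + ⋯`, the `j`-invariant of `ℂ/(ℤτ + ℤ)`, `kleinJ_eq_periodPair_j`), and
  `log|j(τ)|` is `Real.log ‖kleinJ τ‖` (`= 0` if `j(τ) = 0`, harmless inside `max{1, ·}`).
* Mathlib / tree search (`lean search`): no Néron function, no `B₂`-form local height, no
  Hindry–Silverman estimate (`lean search --decl 'neronFunction|NeronFunction'`,
  `'bernoulliTwo|BernoulliTwo'`, `'HindrySilverman'`: no matches); Mathlib has
  `Polynomial.bernoulli` (over `ℚ`; `bernoulliTwo_eq_eval_bernoulli` links to it), `ModularGroup.fd`,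
  `NormedField.toAbsoluteValue`; the tree has `kleinJ`, `PeriodPair.ofUpperHalfPlane`, `mulLeft`.

## References

* J. H. Silverman, *Advanced Topics in the Arithmetic of Elliptic Curves*, GTM 151 (1994),
  Thm. VI.1.1, Thm. VI.3.2, Thm. VI.3.4 (p. 466), Cor. VI.3.3; *The Arithmetic of Elliptic Curves*,
  2nd ed. (2009), Prop. VI.3.6, Thm. VI.5.1.
* C. Petsche, *Small rational points on elliptic curves over number fields*, New York J. Math. 12
  (2006), 257–268 (arXiv math/0508160), Lemma 5 and the proof of Prop. 7.
* M. Hindry, J. H. Silverman, *The canonical height and integral points on elliptic curves*,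
  Invent. Math. 93 (1988), 419–450, Prop. 2.3; *Sur le nombre de points de torsion rationnels sur une
  courbe elliptique*, C. R. Acad. Sci. Paris Sér. I 329 (1999), 97–100, Lemme 1.
-/

noncomputable section

open scoped UpperHalfPlane Modular Real

open Complex

namespace Literature.NumberTheory.EllipticCurves

/-! ### The Néron function on `ℂ/(ℤτ + ℤ)` (ATAEC Thm. VI.3.4) -/

/-- The **second Bernoulli polynomial** `B₂(T) = T² − T + 1/6` (ATAEC Thm. VI.3.4: "where
`B₂(T) = T² − T + 1/6` is the second Bernoulli polynomial"), as a real function.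
[cite: Silverman1994, Thm VI.3.4] -/
def bernoulliTwo (T : ℝ) : ℝ :=
  T ^ 2 - T + 1 / 6

/-- Unfolding lemma for `bernoulliTwo`. [folklore] -/
theorem bernoulliTwo_def (T : ℝ) : bernoulliTwo T = T ^ 2 - T + 1 / 6 := rfl

/-- `bernoulliTwo` is Mathlib's second Bernoulli polynomial `Polynomial.bernoulli 2 ∈ ℚ[X]`
evaluated over `ℝ`. [folklore] -/
theorem bernoulliTwo_eq_eval_bernoulli (T : ℝ) :
    bernoulliTwo T = ((Polynomial.bernoulli 2).map (algebraMap ℚ ℝ)).eval T := by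
  simp [bernoulliTwo, Polynomial.bernoulli, Finset.sum_range_succ, _root_.bernoulli,
    Polynomial.eval_monomial]
  ring

/-- `B₂(−T) = B₂(T) + 2T`. [folklore] -/
theorem bernoulliTwo_neg (T : ℝ) : bernoulliTwo (-T) = bernoulliTwo T + 2 * T := by
  simp only [bernoulliTwo]
  ring

/-- `B₂(T + 1) = B₂(T) + 2T`. [folklore] -/
theorem bernoulliTwo_add_one (T : ℝ) : bernoulliTwo (T + 1) = bernoulliTwo T + 2 * T := by
  simp only [bernoulliTwo]
  ring

/-- The **Néron function on the complex torus `ℂ/(ℤτ + ℤ)`** (Silverman, *Advanced Topics*,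
Thm. VI.3.4, p. 466): for `τ` in the upper half plane and `z ∈ ℂ`, with `u = e^{2πiz}` and
`q = e^{2πiτ}`,
`λ(z) = −½ B₂(Im z / Im τ) · log|q| − log|1 − u| − Σ_{n ≥ 1} log|(1 − qⁿu)(1 − qⁿu⁻¹)|`,
`B₂(T) = T² − T + 1/6`. This is the local height function of the elliptic curve
`E(ℂ) ≅ ℂ/(ℤτ + ℤ)` at the archimedean place (loc. cit.; equivalently
`λ(z) = −log|e^{−½zη(z)} σ(z) Δ(Λ)^{1/12}|`, Thm. VI.3.2 / Cor. VI.3.3), in Silverman's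
normalisation. It is `(ℤτ + ℤ)`-periodic and even; on the lattice itself (where `λ` has its
logarithmic pole) the value is junk (`Real.log 0 = 0`). The sum is a `tsum` over `n + 1`, `n : ℕ`.
[cite: Silverman1994, Thm VI.3.4] -/
def neronFunction (τ : ℍ) (z : ℂ) : ℝ :=
  -(1 / 2 * bernoulliTwo (z.im / τ.im) * Real.log ‖cexp (2 * π * I * τ)‖) -
      Real.log ‖1 - cexp (2 * π * I * z)‖ -
    ∑' n : ℕ, Real.log ‖(1 - cexp (2 * π * I * τ) ^ (n + 1) * cexp (2 * π * I * z)) *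
      (1 - cexp (2 * π * I * τ) ^ (n + 1) * (cexp (2 * π * I * z))⁻¹)‖

/-- Unfolding lemma for `neronFunction` (ATAEC Thm. VI.3.4). [cite: Silverman1994, Thm VI.3.4] -/
theorem neronFunction_def (τ : ℍ) (z : ℂ) :
    neronFunction τ z =
      -(1 / 2 * bernoulliTwo (z.im / τ.im) * Real.log ‖cexp (2 * π * I * τ)‖) -
          Real.log ‖1 - cexp (2 * π * I * z)‖ -
        ∑' n : ℕ, Real.log ‖(1 - cexp (2 * π * I * τ) ^ (n + 1) * cexp (2 * π * I * z)) *
          (1 - cexp (2 * π * I * τ) ^ (n + 1) * (cexp (2 * π * I * z))⁻¹)‖ := rfl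

/-- `log|e^{2πiw}| = −2π Im w`. [folklore] -/
theorem log_norm_cexp_two_pi_I_mul (w : ℂ) : Real.log ‖cexp (2 * π * I * w)‖ = -(2 * π * w.im) := by
  rw [norm_exp, Real.log_exp]
  simp [mul_comm]

/-- `log|q| = −2π Im τ < 0` for `q = e^{2πiτ}`, `τ ∈ ℍ` (ATAEC Rem. VI.3.4.1: `v(q) = −log|q| > 0`).
[folklore] -/
theorem log_norm_cexp_two_pi_I_mul_neg (τ : ℍ) : Real.log ‖cexp (2 * π * I * τ)‖ < 0 := by
  rw [log_norm_cexp_two_pi_I_mul, UpperHalfPlane.coe_im, neg_lt_zero]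
  exact mul_pos (mul_pos two_pos Real.pi_pos) τ.im_pos

/-- `e^{2πi(z + 1)} = e^{2πiz}`. [folklore] -/
theorem cexp_two_pi_I_mul_add_one (z : ℂ) : cexp (2 * π * I * (z + 1)) = cexp (2 * π * I * z) := by
  rw [mul_add, mul_one, exp_add, exp_two_pi_mul_I, mul_one]

/-- The Néron function is `1`-periodic: `λ(z + 1) = λ(z)` (`u` and `Im z` are unchanged).
[cite: Silverman1994, Thm VI.3.4] -/
theorem neronFunction_add_one (τ : ℍ) (z : ℂ) : neronFunction τ (z + 1) = neronFunction τ z := by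
  simp only [neronFunction, cexp_two_pi_I_mul_add_one, add_im, one_im, add_zero]

/-- The Néron function is even: `λ(−z) = λ(z)` (`u ↦ u⁻¹` exchanges the two factors of the product,
`−log|1 − u⁻¹| = −log|1 − u| + log|u|`, `log|u| = (Im z / Im τ) log|q|` and
`B₂(−T) = B₂(T) + 2T`). [cite: Silverman1994, Thm VI.3.4] -/
theorem neronFunction_neg (τ : ℍ) (z : ℂ) : neronFunction τ (-z) = neronFunction τ z := by
  have hu : cexp (2 * π * I * z) ≠ 0 := exp_ne_zero _
  have hneg : cexp (2 * π * I * -z) = (cexp (2 * π * I * z))⁻¹ := by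
    rw [mul_neg, exp_neg]
  have hlogu : Real.log ‖cexp (2 * π * I * z)‖ =
      z.im / τ.im * Real.log ‖cexp (2 * π * I * τ)‖ := by
    rw [log_norm_cexp_two_pi_I_mul, log_norm_cexp_two_pi_I_mul, UpperHalfPlane.coe_im]
    field_simp [τ.im_pos.ne']
  have h1 : Real.log ‖1 - (cexp (2 * π * I * z))⁻¹‖ =
      Real.log ‖1 - cexp (2 * π * I * z)‖ - Real.log ‖cexp (2 * π * I * z)‖ := by
    have : 1 - (cexp (2 * π * I * z))⁻¹ = -((1 - cexp (2 * π * I * z)) * (cexp (2 * π * I * z))⁻¹) := by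
      field_simp
      ring
    rw [this, norm_neg, norm_mul, norm_inv]
    by_cases h0 : cexp (2 * π * I * z) = 1
    · simp [h0]
    · have h0' : ‖1 - cexp (2 * π * I * z)‖ ≠ 0 :=
        norm_ne_zero_iff.mpr (sub_ne_zero.mpr (Ne.symm h0))
      rw [Real.log_mul h0' (inv_ne_zero (norm_ne_zero_iff.mpr hu)), Real.log_inv]
      ring
  simp only [neronFunction, hneg, inv_inv, neg_im, neg_div, bernoulliTwo_neg, h1, hlogu]
  have hsum : (fun n : ℕ => Real.log ‖(1 - cexp (2 * π * I * τ) ^ (n + 1) * (cexp (2 * π * I * z))⁻¹) *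
      (1 - cexp (2 * π * I * τ) ^ (n + 1) * cexp (2 * π * I * z))‖) =
      fun n : ℕ => Real.log ‖(1 - cexp (2 * π * I * τ) ^ (n + 1) * cexp (2 * π * I * z)) *
        (1 - cexp (2 * π * I * τ) ^ (n + 1) * (cexp (2 * π * I * z))⁻¹)‖ := by
    funext n
    rw [mul_comm]
  rw [hsum]
  ring

/-! ### ATAEC Thm. VI.3.4: the local height on `E(ℂ)` is the Néron function (named fact) -/

/-- **Silverman, *Advanced Topics*, Thm. VI.3.4** (p. 466; with Thm. VI.1.1(b), independence of
the Weierstrass equation): *let `E/ℂ` be an elliptic curve with lattice `ℤτ + ℤ` normalised so that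
`Im τ > 0`, `u = e^{2πiz}`, `q = e^{2πiτ}`, and identify `E(ℂ) ≅ ℂ/(ℤτ + ℤ)`; then the local
height function `λ : E(ℂ) ∖ {O} → ℝ` is given by the formula
`λ(z) = −½ B₂(Im z/Im τ) log|q| − log|1 − u| − Σ_{n≥1} log|(1 − qⁿu)(1 − qⁿu⁻¹)|`.*
Formalisation: `E` is given by an arbitrary Weierstrass equation `W` over `ℂ`; its period lattice
is `Λ_W = c(ℤτ + ℤ)` (`(PeriodPair.ofUpperHalfPlane τ).mulLeft c hc`, characterised by
`g₂(Λ_W) = c₄(W)/12`, `g₃(Λ_W) = c₆(W)/216`), the analytic isomorphism `ℂ/Λ_W ≅ W(ℂ)` is the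
homomorphism `u : ℂ →+ W(ℂ)` given off `Λ_W` by
`w ↦ (℘(w) − b₂/12, (℘'(w) − a₁(℘(w) − b₂/12) − a₃)/2)` (AEC Prop. VI.3.6(b) in the coordinates of
`W`; it exists by the tree's `PeriodPair.exists_addMonoidHom_of_g₂_g₃`), so that
`ℂ/(ℤτ + ℤ) ≅ E(ℂ)` is `z ↦ u(cz)`; `λ` is Tate's series `neronLocalHeight` for the usual
absolute value `NormedField.toAbsoluteValue ℂ` (the function of Thm. VI.1.1 over the complete
field `ℂ`), and the conclusion is `λ(u(cz)) = neronFunction τ z` for every `z ∉ ℤτ + ℤ`.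
[cite: Silverman1994, Thm VI.3.4] -/
def neronLocalHeight_eq_neronFunction : Prop :=
  ∀ (W : WeierstrassCurve ℂ) [W.IsElliptic] (τ : ℍ) (c : ℂ) (hc : c ≠ 0),
    ((PeriodPair.ofUpperHalfPlane τ).mulLeft c hc).g₂ = W.c₄ / 12 →
    ((PeriodPair.ofUpperHalfPlane τ).mulLeft c hc).g₃ = W.c₆ / 216 →
    ∀ u : ℂ →+ W.toAffine.Point,
      (∀ w ∉ ((PeriodPair.ofUpperHalfPlane τ).mulLeft c hc).lattice,
        ∃ hw, u w = .some (((PeriodPair.ofUpperHalfPlane τ).mulLeft c hc).weierstrassP w - W.b₂ / 12)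
          ((((PeriodPair.ofUpperHalfPlane τ).mulLeft c hc).derivWeierstrassP w -
            W.a₁ * (((PeriodPair.ofUpperHalfPlane τ).mulLeft c hc).weierstrassP w - W.b₂ / 12) -
              W.a₃) / 2) hw) →
      ∀ z ∉ (PeriodPair.ofUpperHalfPlane τ).lattice,
        (u (c * z)).neronLocalHeight (NormedField.toAbsoluteValue ℂ) = neronFunction τ z

/-! ### Hindry–Silverman's archimedean estimate (Petsche 2006, Lemma 5; named fact) -/

open Literature.NumberTheory.EllipticCurves.ModularForms in
/-- **Petsche 2006, Lemma 5 (Hindry–Silverman)** (New York J. Math. 12 (2006), p. 261; arXiv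
math/0508160 p. 5; "cf. Lemma 1 of [Hindry–Silverman, C. R. Acad. Sci. 329 (1999)] and Prop. 2.3 of
[Hindry–Silverman, Invent. Math. 93 (1988)]"): *let `j : ℍ → ℂ` denote the modular `j`-function,
and let `L = ℤ + τℤ` be a normalized lattice with `τ ∈ ℍ`; thus `j(τ)` is the `j`-invariant of the
elliptic curve `ℂ/L`. Let `λ : (ℂ/L) ∖ {0} → ℝ` denote the Néron function, as given in
[Silverman, ATAEC], §VI.3. If `z = r₁ + r₂τ ∈ ℂ ∖ {0}`, where `r₁, r₂ ∈ ℝ` and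
`max{|r₁|, |r₂|} ≤ 1/24`, then `λ(z) ≥ (1/288) max{1, log|j(τ)|}`.* "Normalized" is taken in the
sense of Hindry–Silverman: `τ` in the standard fundamental domain `𝒟 = {|τ| ≥ 1, |Re τ| ≤ ½}`
(Mathlib `ModularGroup.fd`); `λ = neronFunction τ` (ATAEC Thm. VI.3.4) and `j = kleinJ`
(`= E₄³/Δ`, the `j`-invariant of `ℂ/(ℤτ + ℤ)`). Petsche gives no proof; the estimate is
Hindry–Silverman's explicit minoration of `λ` near the origin from the `q`-expansion.
[cite: Petsche2006, Lemma 5] -/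
def Petsche2006_lemma5 : Prop :=
  ∀ τ : ℍ, τ ∈ 𝒟 → ∀ r₁ r₂ : ℝ, max |r₁| |r₂| ≤ 1 / 24 → (r₁ : ℂ) + r₂ * (τ : ℂ) ≠ 0 →
    1 / 288 * max 1 (Real.log ‖kleinJ τ‖) ≤ neronFunction τ (r₁ + r₂ * (τ : ℂ))

end Literature.NumberTheory.EllipticCurves

end
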